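import Mathlib
import Literature.MathematicalPhysics.QuantumLattice.WilsonDiracAP
import Summits.QuantumFields.QCD.Theorems.QuarksAsStableActionCriticalLineDiamagnetismStubBlochFactorisation
import Summits.QuantumFields.QCD.Theorems.QuarksAsStableActionCriticalLineDiamagnetismStubFreeDetFormula
import Summits.QuantumFields.QCD.Theorems.QuarksAsStableActionCriticalLineDiamagnetismStubCellGainOfGauged

/-!
# Bloch factorisation of the one-cell antiperiodic determinants on the even torus
(helper for crux stmt-QuantumFields-9734, line `Sketch`, stub `stub_cellDetFactorisation`)

What.  On the even torus `(ℤ/2M)⁴`, for a `U(3)` field `V`, a cell corner `c`, a bare mass `m`, the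
central phases `ω = e^{iπ/2M}·1` and `ζ_k(μ) = e^{iπ k_μ/M}·1` (`k ∈ {0,…,M-1}⁴`):
(i) `det D_AP[tile_c V] = ∏_k det D^{(2)}[e ↦ ζ_k(e.2) ω W_c(e)]` and
(ii) `det D_AP[1] = ∏_k det D^{(2)}[e ↦ ζ_k(e.2) ω]`, where `D_AP[X]` is the tree's `r = 1`
Wilson–Dirac operator of the seam-twisted field (`-X` on the links leaving the slice `val x_μ = 2M - 1`
in direction `μ`), `tile_c V` is the period-2 reflection tiling of the line and `W_c` is the tiling read
at the representatives `c + a`, `a ∈ {0,1}⁴`, a field on the small torus `(ℤ/2)⁴`.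

How.  (1) SEAM ↔ PHASE (`gaugeTransform_phase_mul_eq_seam`, generalising
`FreeDetFormula.gaugeTransform_phase_eq_seam` to an arbitrary field `X`; `ω` is central): with
`s x := ω ^ (Σ_ν val x_ν)` one has `(ω • X)^s = seam X`, so `det D_AP[X] = det D[ω • X]` by gauge
invariance of the fermion determinant (`fermionDet_wilsonDirac_gaugeTransform`).
(2) TRANSLATION (`det_wilsonDirac_translate`, from the tree's `fermionDet_wilsonDirac_torusConfigShift`):
`det D[U] = det D[e ↦ U(e.1 + c, e.2)]`, moving the corner to the origin.
(3) PERIODICITY (`tile_congr`, even side): `tile_c V (x, μ)` only depends on the parities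
`val (x_ν - c_ν) mod 2`, hence `ω · tile_c V (x + c, μ) = ω · W_c (x mod 2, μ)`.
(4) The landed Bloch–Floquet factorisation `stub_blochFactorisation` of period-2 fields.
Part (ii) is (1) with `X = 1` and (4) for the constant cell field `ω`.
References: Bloch–Floquet reduction (folklore); Montvay–Münster, *Quantum Fields on a Lattice* §4.2.4
(antiperiodic Wilson fermions as constant `U(1)` phases).  Pure theorem file (no `def`s).
-/

noncomputable section

open scoped BigOperators Classical Matrix ComplexConjugate
open Finset
open Literature.MathematicalPhysics.QuantumLattice Literature.MathematicalPhysics.QuantumFieldTheory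
  Literature.Probability.LatticeModels

namespace Summit.QuantumFields.QCD.Cruxes.CriticalLineDiamagnetism.ChessboardCellGain

namespace CellDetFactorisation

variable {L : ℕ}

/-! ### Seam ↔ phase for an arbitrary field -/

/-- A scalar unitary matrix is central in `U(3)`. -/
theorem phase_comm {ω : Matrix.unitaryGroup (Fin 3) ℂ}
    (hω : (ω : Matrix (Fin 3) (Fin 3) ℂ) =
      Complex.exp (↑(Real.pi / L) * Complex.I) • (1 : Matrix (Fin 3) (Fin 3) ℂ))
    (u : Matrix.unitaryGroup (Fin 3) ℂ) : Commute ω u := by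
  -- adapted from `phase_comm` of `…WilsonQuarkStabilityStubTilingStability.lean`
  rw [Commute, SemiconjBy]
  apply Subtype.ext
  change (ω : Matrix (Fin 3) (Fin 3) ℂ) * u = u * ω
  rw [hω, smul_mul_assoc, one_mul, mul_smul_comm, mul_one]

/-- **Seam ↔ phase** for an arbitrary `U(3)` field `X`.  With `s x := ω ^ (Σ_ν val x_ν)`,
`ω = e^{iπ/L}·1`, the gauge transform of `e ↦ ω X_e` by `s` is the seam-twisted field: off the seam
the scalar factor is `ω^{n+1} ω^{-(n+1)} = 1`, on the seam `val x_μ + 1 = L` the exponent drops by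
`L - 1` and the factor is `ω^L = -1` (`ω` is central). -/
theorem gaugeTransform_phase_mul_eq_seam [NeZero L] {ω : Matrix.unitaryGroup (Fin 3) ℂ}
    (hω : (ω : Matrix (Fin 3) (Fin 3) ℂ) =
      Complex.exp (↑(Real.pi / L) * Complex.I) • (1 : Matrix (Fin 3) (Fin 3) ℂ))
    (X : GaugeConfig 4 L (Matrix.unitaryGroup (Fin 3) ℂ)) :
    gaugeTransform (fun x : Site 4 L => ω ^ (∑ ν, (x ν).val)) (fun e => ω * X e) =
      fun e : Edge 4 L => if (e.1 e.2).val + 1 = L then -X e else X e := by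
  -- adapted from `gaugeTransform_phase_eq_apTwistAt` of `…WilsonQuarkStabilityStubTilingStability.lean`
  rw [CellGainOfGauged.seam_eq_apTwistAt X]
  funext ⟨x, μ⟩
  rw [apTwistAt_apply]
  simp only [gaugeTransform]
  have hx : ∑ ν, (x ν).val = (x μ).val + ∑ ν ∈ Finset.univ.erase μ, (x ν).val :=
    (Finset.add_sum_erase _ _ (Finset.mem_univ μ)).symm
  have hxs : ∑ ν, (Site.shift x μ ν).val = (x μ + 1).val + ∑ ν ∈ Finset.univ.erase μ, (x ν).val := by
    rw [← Finset.add_sum_erase _ _ (Finset.mem_univ μ), FreeDetFormula.shift_apply_self]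
    congr 1
    exact Finset.sum_congr rfl fun ν hν => by
      rw [FreeDetFormula.shift_apply_of_ne x (Finset.ne_of_mem_erase hν)]
  rw [hx, hxs]
  set n := ∑ ν ∈ Finset.univ.erase μ, (x ν).val with hn
  have hre : ω ^ ((x μ).val + n) * (ω * X (x, μ)) * (ω ^ ((x μ + 1).val + n))⁻¹ =
      ω ^ ((x μ).val + n + 1) * (ω ^ ((x μ + 1).val + n))⁻¹ * X (x, μ) := by
    rw [← mul_assoc (ω ^ _) ω, ← pow_succ, mul_assoc, mul_assoc,
      (((phase_comm hω (X (x, μ))).pow_left _).inv_left).eq]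
  rw [hre]
  by_cases h : x μ = -1
  · rw [if_pos h, h, neg_add_cancel, ZMod.val_zero, zero_add, FreeDetFormula.zmod_val_neg_one,
      show L - 1 + n + 1 = L + n by have := NeZero.one_le (n := L); omega, pow_add,
      mul_inv_cancel_right, FreeDetFormula.phase_pow hω, neg_one_mul]
  · rw [if_neg h, FreeDetFormula.zmod_val_add_one h, add_right_comm (x μ).val n 1, mul_inv_cancel,
      one_mul]

/-- **Seam ↔ phase for the determinant**: `det D_AP[X] = det D[ω • X]`, `ω = e^{iπ/L}·1`
(gauge invariance of the Wilson fermion determinant). -/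
theorem det_seam_eq_det_phase_mul [NeZero L] (m : ℝ) {ω : Matrix.unitaryGroup (Fin 3) ℂ}
    (hω : (ω : Matrix (Fin 3) (Fin 3) ℂ) =
      Complex.exp (↑(Real.pi / L) * Complex.I) • (1 : Matrix (Fin 3) (Fin 3) ℂ))
    (X : GaugeConfig 4 L (Matrix.unitaryGroup (Fin 3) ℂ)) :
    (wilsonDirac (unitaryFundamentalRep (Fin 3) ℂ)
        (fun e : Edge 4 L => if (e.1 e.2).val + 1 = L then -X e else X e) m 1).det =
      (wilsonDirac (unitaryFundamentalRep (Fin 3) ℂ) (fun e : Edge 4 L => ω * X e) m 1).det := by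
  have h := fermionDet_wilsonDirac_gaugeTransform (unitaryFundamentalRep (Fin 3) ℂ)
    (fun x : Site 4 L => ω ^ (∑ ν, (x ν).val)) (fun e : Edge 4 L => ω * X e) m 1
  rw [gaugeTransform_phase_mul_eq_seam hω X] at h
  exact h

/-! ### Translations and the period-2 structure of the tiling -/

/-- **Translation invariance**: `det D[e ↦ U(e.1 + v, e.2)] = det D[U]`
(the tree's `fermionDet_wilsonDirac_torusConfigShift` at `-v`). -/
theorem det_wilsonDirac_translate [NeZero L] (U : GaugeConfig 4 L (Matrix.unitaryGroup (Fin 3) ℂ))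
    (v : Site 4 L) (m : ℝ) :
    (wilsonDirac (unitaryFundamentalRep (Fin 3) ℂ) (fun e : Edge 4 L => U (e.1 + v, e.2)) m 1).det =
      (wilsonDirac (unitaryFundamentalRep (Fin 3) ℂ) U m 1).det := by
  have h : (fun e : Edge 4 L => U (e.1 + v, e.2)) = torusConfigShift (-v) U := by
    funext e
    rw [torusConfigShift_apply, sub_neg_eq_add]
  rw [h]
  exact fermionDet_wilsonDirac_torusConfigShift _ (-v) U m 1

/-- **Period-2 structure of the reflection tiling** (even `L`): a field `T` satisfying the defining
equation of `tile_c V` only depends, on the edge `(x, μ)`, on the parities `val (x_ν - c_ν) mod 2` (in the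
backward branch, `val ((x_μ + 1) - c_μ) mod 2` is determined by `val (x_μ - c_μ) mod 2` because `L` is
even). -/
theorem tile_congr [NeZero L] (hL : Even L) (c : Site 4 L)
    (V : GaugeConfig 4 L (Matrix.unitaryGroup (Fin 3) ℂ)) {T : GaugeConfig 4 L (Matrix.unitaryGroup (Fin 3) ℂ)}
    (hT : ∀ (x : Site 4 L) (μ : Fin 4), T (x, μ) = if (x μ - c μ).val % 2 = 0
        then V (fun ν => c ν + (((x ν - c ν).val % 2 : ℕ) : ZMod L), μ)
        else (V (fun ν => c ν + (((Site.shift x μ ν - c ν).val % 2 : ℕ) : ZMod L), μ))⁻¹)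
    {x y : Site 4 L} (μ : Fin 4) (h : ∀ ν, (x ν - c ν).val % 2 = (y ν - c ν).val % 2) :
    T (x, μ) = T (y, μ) := by
  have hs : ∀ ν, (Site.shift x μ ν - c ν).val % 2 = (Site.shift y μ ν - c ν).val % 2 := by
    intro ν
    by_cases hν : ν = μ
    · subst hν
      rw [FreeDetFormula.shift_apply_self, FreeDetFormula.shift_apply_self, add_sub_right_comm,
        add_sub_right_comm (y ν), CellGainOfGauged.zmod_val_add_one_mod_two hL,
        CellGainOfGauged.zmod_val_add_one_mod_two hL, Nat.add_mod, h ν, ← Nat.add_mod]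
    · rw [FreeDetFormula.shift_apply_of_ne x hν, FreeDetFormula.shift_apply_of_ne y hν, h ν]
  have h1 : (fun ν => c ν + (((x ν - c ν).val % 2 : ℕ) : ZMod L)) =
      fun ν => c ν + (((y ν - c ν).val % 2 : ℕ) : ZMod L) := funext fun ν => by rw [h ν]
  have h2 : (fun ν => c ν + (((Site.shift x μ ν - c ν).val % 2 : ℕ) : ZMod L)) =
      fun ν => c ν + (((Site.shift y μ ν - c ν).val % 2 : ℕ) : ZMod L) := funext fun ν => by rw [hs ν]
  rw [hT, hT, h μ, h1, h2]

/-- The representative `c + a` of the parity class of `x + c`: for `a_ν := val x_ν mod 2` (read in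
`ℤ/2` and lifted back to `ℤ/L`), `val ((x + c)_ν - c_ν) ≡ val ((c + a)_ν - c_ν) (mod 2)`. -/
theorem parity_translate_eq_parity_rep [NeZero L] (c x : Site 4 L) (ν : Fin 4) :
    ((x + c) ν - c ν).val % 2 =
      ((fun κ => c κ + ((((((x κ).val : ℕ) : ZMod 2)).val : ℕ) : ZMod L)) ν - c ν).val % 2 := by
  rw [Pi.add_apply, add_sub_cancel_right, add_sub_cancel_left, ZMod.val_natCast, ZMod.val_natCast,
    Nat.mod_eq_of_lt (lt_of_le_of_lt (Nat.mod_le _ _) (ZMod.val_lt (x ν))), Nat.mod_mod]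

/-! ### The two factorisations, for a tiled field `T` given by its defining equation -/

/-- Periodicity of the phase-twisted tiling after translation by the corner `c`:
`ω · T(x + c, μ) = ω · T(c + a(x), μ)` with `a(x)_ν = val x_ν mod 2` read in `ℤ/2` and lifted to `ℤ/2M`;
the right-hand side is the period-2 extension of the cell field `e ↦ ω · T(c + e.1, e.2)`. -/
theorem phase_tile_translate_eq {M : ℕ} [NeZero M]
    (V : GaugeConfig 4 (2 * M) (Matrix.unitaryGroup (Fin 3) ℂ)) (c : Site 4 (2 * M))
    (ω : Matrix.unitaryGroup (Fin 3) ℂ) {T : GaugeConfig 4 (2 * M) (Matrix.unitaryGroup (Fin 3) ℂ)}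
    (hT : ∀ (x : Site 4 (2 * M)) (μ : Fin 4), T (x, μ) = if (x μ - c μ).val % 2 = 0
        then V (fun ν => c ν + (((x ν - c ν).val % 2 : ℕ) : ZMod (2 * M)), μ)
        else (V (fun ν => c ν + (((Site.shift x μ ν - c ν).val % 2 : ℕ) : ZMod (2 * M)), μ))⁻¹) :
    (fun e : Edge 4 (2 * M) => ω * T (e.1 + c, e.2)) = fun e : Edge 4 (2 * M) =>
      ω * T (fun ν => c ν + ((((((e.1 ν).val : ℕ) : ZMod 2)).val : ℕ) : ZMod (2 * M)), e.2) := by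
  funext ⟨x, μ⟩
  show ω * T (x + c, μ) = ω * T (fun ν => c ν + ((((((x ν).val : ℕ) : ZMod 2)).val : ℕ) : ZMod (2 * M)), μ)
  rw [tile_congr (even_two_mul M) c V hT μ (parity_translate_eq_parity_rep c x)]

/-- **Part (i) for a tiled field.**  If `T` satisfies the defining equation of `tile_c V`, then
`det D_AP[T] = ∏_k det D^{(2)}[e ↦ ζ_k(e.2) ω T(c + e.1, e.2)]`: seam ↔ phase, translation by `c`,
periodicity, and the Bloch–Floquet factorisation `stub_blochFactorisation` of the period-2 field. -/
theorem det_seam_tile_eq {M : ℕ} [NeZero M] (m : ℝ)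
    (V : GaugeConfig 4 (2 * M) (Matrix.unitaryGroup (Fin 3) ℂ)) (c : Site 4 (2 * M))
    {ω : Matrix.unitaryGroup (Fin 3) ℂ}
    (hω : (ω : Matrix (Fin 3) (Fin 3) ℂ) =
      Complex.exp (↑(Real.pi / (2 * M : ℕ)) * Complex.I) • (1 : Matrix (Fin 3) (Fin 3) ℂ))
    (ζ : (Fin 4 → Fin M) → Fin 4 → Matrix.unitaryGroup (Fin 3) ℂ)
    (hζ : ∀ k μ, ((ζ k μ : Matrix.unitaryGroup (Fin 3) ℂ) : Matrix (Fin 3) (Fin 3) ℂ) =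
      Complex.exp (Real.pi * Complex.I * ((k μ : ℕ) : ℂ) / (M : ℂ)) • (1 : Matrix (Fin 3) (Fin 3) ℂ))
    (T : GaugeConfig 4 (2 * M) (Matrix.unitaryGroup (Fin 3) ℂ))
    (hT : ∀ (x : Site 4 (2 * M)) (μ : Fin 4), T (x, μ) = if (x μ - c μ).val % 2 = 0
        then V (fun ν => c ν + (((x ν - c ν).val % 2 : ℕ) : ZMod (2 * M)), μ)
        else (V (fun ν => c ν + (((Site.shift x μ ν - c ν).val % 2 : ℕ) : ZMod (2 * M)), μ))⁻¹) :
    (wilsonDirac (unitaryFundamentalRep (Fin 3) ℂ)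
        (fun e : Edge 4 (2 * M) => if (e.1 e.2).val + 1 = 2 * M then -T e else T e) m 1).det =
      ∏ k : Fin 4 → Fin M, (wilsonDirac (unitaryFundamentalRep (Fin 3) ℂ)
        (fun e : Edge 4 2 => ζ k e.2 * ω * T (fun ν => c ν + (((e.1 ν).val : ℕ) : ZMod (2 * M)), e.2)) m 1).det :=
  calc (wilsonDirac (unitaryFundamentalRep (Fin 3) ℂ)
          (fun e : Edge 4 (2 * M) => if (e.1 e.2).val + 1 = 2 * M then -T e else T e) m 1).det
      = (wilsonDirac (unitaryFundamentalRep (Fin 3) ℂ) (fun e : Edge 4 (2 * M) => ω * T e) m 1).det :=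
        det_seam_eq_det_phase_mul m hω T
    _ = (wilsonDirac (unitaryFundamentalRep (Fin 3) ℂ)
          (fun e : Edge 4 (2 * M) => ω * T (e.1 + c, e.2)) m 1).det :=
        (det_wilsonDirac_translate (fun e : Edge 4 (2 * M) => ω * T e) c m).symm
    _ = (wilsonDirac (unitaryFundamentalRep (Fin 3) ℂ) (fun e : Edge 4 (2 * M) =>
          ω * T (fun ν => c ν + ((((((e.1 ν).val : ℕ) : ZMod 2)).val : ℕ) : ZMod (2 * M)), e.2)) m 1).det := by
        rw [phase_tile_translate_eq V c ω hT]
    _ = ∏ k : Fin 4 → Fin M, (wilsonDirac (unitaryFundamentalRep (Fin 3) ℂ) (fun e : Edge 4 2 =>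
          ζ k e.2 * (ω * T (fun ν => c ν + (((e.1 ν).val : ℕ) : ZMod (2 * M)), e.2))) m 1).det :=
        stub_blochFactorisation 3 M m 1
          (fun e : Edge 4 2 => ω * T (fun ν => c ν + (((e.1 ν).val : ℕ) : ZMod (2 * M)), e.2)) ζ hζ
    _ = ∏ k : Fin 4 → Fin M, (wilsonDirac (unitaryFundamentalRep (Fin 3) ℂ) (fun e : Edge 4 2 =>
          ζ k e.2 * ω * T (fun ν => c ν + (((e.1 ν).val : ℕ) : ZMod (2 * M)), e.2)) m 1).det := by
        simp only [mul_assoc]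

/-- **Part (ii).**  `det D_AP[1] = ∏_k det D^{(2)}[e ↦ ζ_k(e.2) ω]`: seam ↔ phase with `X = 1`, then the
Bloch–Floquet factorisation of the constant field `ω`. -/
theorem det_seam_one_eq {M : ℕ} [NeZero M] (m : ℝ) {ω : Matrix.unitaryGroup (Fin 3) ℂ}
    (hω : (ω : Matrix (Fin 3) (Fin 3) ℂ) =
      Complex.exp (↑(Real.pi / (2 * M : ℕ)) * Complex.I) • (1 : Matrix (Fin 3) (Fin 3) ℂ))
    (ζ : (Fin 4 → Fin M) → Fin 4 → Matrix.unitaryGroup (Fin 3) ℂ)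
    (hζ : ∀ k μ, ((ζ k μ : Matrix.unitaryGroup (Fin 3) ℂ) : Matrix (Fin 3) (Fin 3) ℂ) =
      Complex.exp (Real.pi * Complex.I * ((k μ : ℕ) : ℂ) / (M : ℂ)) • (1 : Matrix (Fin 3) (Fin 3) ℂ)) :
    (wilsonDirac (unitaryFundamentalRep (Fin 3) ℂ)
        (fun e : Edge 4 (2 * M) => if (e.1 e.2).val + 1 = 2 * M
          then -(1 : GaugeConfig 4 (2 * M) (Matrix.unitaryGroup (Fin 3) ℂ)) e
          else (1 : GaugeConfig 4 (2 * M) (Matrix.unitaryGroup (Fin 3) ℂ)) e) m 1).det =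
      ∏ k : Fin 4 → Fin M,
        (wilsonDirac (unitaryFundamentalRep (Fin 3) ℂ) (fun e : Edge 4 2 => ζ k e.2 * ω) m 1).det := by
  have h1 := det_seam_eq_det_phase_mul m hω (1 : GaugeConfig 4 (2 * M) (Matrix.unitaryGroup (Fin 3) ℂ))
  simp only [Pi.one_apply, mul_one] at h1
  exact h1.trans (stub_blochFactorisation 3 M m 1 (fun _ : Edge 4 2 => ω) ζ hζ)

end CellDetFactorisation

/-- **Stub 3a (Bloch factorisation of the one-cell antiperiodic determinants).**  On the even torus
`(ℤ/2M)⁴`, with `ω = e^{iπ/2M}·1` and `ζ_k(μ) = e^{iπk_μ/M}·1`: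
(i) `det D_AP[tile_c V] = ∏_{k ∈ {0,…,M-1}⁴} det D^{(2)}[e ↦ ζ_k(e.2) ω W_c(e)]`, `W_c` the tiling read at
the representatives `c + a`, `a ∈ {0,1}⁴`; (ii) `det D_AP[1] = ∏_k det D^{(2)}[e ↦ ζ_k(e.2) ω]`
(`CellDetFactorisation.det_seam_tile_eq`, `CellDetFactorisation.det_seam_one_eq`). -/
theorem stub_cellDetFactorisation : ∀ (M : ℕ) [NeZero M] (m : ℝ) (V : GaugeConfig 4 (2 * M) (Matrix.unitaryGroup (Fin 3) ℂ)) (c : Site 4 (2 * M)) (ω : Matrix.unitaryGroup (Fin 3) ℂ) (ζ : (Fin 4 → Fin M) → Fin 4 → Matrix.unitaryGroup (Fin 3) ℂ), ((ω : Matrix.unitaryGroup (Fin 3) ℂ) : Matrix (Fin 3) (Fin 3) ℂ) = Complex.exp (↑(Real.pi / (2 * M : ℕ)) * Complex.I) • (1 : Matrix (Fin 3) (Fin 3) ℂ) → (∀ k μ, ((ζ k μ : Matrix.unitaryGroup (Fin 3) ℂ) : Matrix (Fin 3) (Fin 3) ℂ) = Complex.exp (Real.pi * Complex.I * ((k μ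 : ℕ) : ℂ) / (M : ℂ)) • (1 : Matrix (Fin 3) (Fin 3) ℂ)) → let dAP : GaugeConfig 4 (2 * M) (Matrix.unitaryGroup (Fin 3) ℂ) → ℝ → ℂ := fun X m => (wilsonDirac (unitaryFundamentalRep (Fin 3) ℂ) (fun e => if (e.1 e.2).val + 1 = 2 * M then -X e else X e) m 1).det; let tile : Site 4 (2 * M) → GaugeConfig 4 (2 * M) (Matrix.unitaryGroup (Fin 3) ℂ) → GaugeConfig 4 (2 * M) (Matrix.unitaryGroup (Fin 3) ℂ) := fun c V e => if (e.1 e.2 - c e.2).val % 2 = 0 then V (fun ν => c ν + (((e.1 ν - c ν).val % 2 : ℕ) : ZMod (2 * M)), e.2) else (V (fun ν => c ν + (((Site.shift e.1 e.2 ν - c ν).val % 2 : ℕ) : ZMod (2 * M)), e.2))⁻¹; let Wc : GaugeConfig 4 2 (Matrix.unitaryGroup (Fin 3) ℂ) := fun e => tile c V (fun ν => c ν + (((e.1 ν).val : ℕ) : ZMod (2 * M)), e.2); dAP (tile c V) m = ∏ k : Fin 4 → Fin M, (wilsonDirac (unitaryFundamentalRep (Fin 3) ℂ) (fun e : Edge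 4 2 => ζ k e.2 * ω * Wc e) m 1).det ∧ dAP 1 m = ∏ k : Fin 4 → Fin M, (wilsonDirac (unitaryFundamentalRep (Fin 3) ℂ) (fun e : Edge 4 2 => ζ k e.2 * ω) m 1).det := by
  intro M _ m V c ω ζ hω hζ dAP tile Wc
  exact ⟨CellDetFactorisation.det_seam_tile_eq m V c hω ζ hζ (tile c V) (fun _ _ => rfl),
    CellDetFactorisation.det_seam_one_eq m hω ζ hζ⟩

end Summit.QuantumFields.QCD.Cruxes.CriticalLineDiamagnetism.ChessboardCellGain

end
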